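import Summits.Langlands.Langlands.Theorems.IrreducibilityBySelfDualityHalfIntegralTwistCMWeilExtensionAux
import Literature.NumberTheory.GaloisRepresentations.HeckeCharacterAutConj
import Literature.NumberTheory.GaloisRepresentations.UnitIdeles
import Literature.NumberTheory.GaloisRepresentations.HeckeCharacterArchType
import HarnessLib

/-!
# `HalfIntegralTwistCM` (stmt-Langlands-14036), line `two-primary-chevalley-core` — stub S2
# `stub_weilExtension`: Weil's extension theorem in CONGRUENCE form, for quasi-characters

Route `IrreducibilityBySelfDuality`, crux `HalfIntegralTwistCM`.  The registered stub (shared with the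
sibling line `chevalley-exponent-saturation`): if the unitary archimedean type `(m, t)` kills the global
units `u ≡ 1 (mod a)` (`a > 0` a rational modulus), then `(m, t)` is the archimedean type of a Hecke
character of `K`.

We prove Weil's extension lemma (Weil 1956 §1; the construction behind Patrikis 2019, Lemma 2.1.1) in the
slightly more general QUASI-CHARACTER form `HeckeCharacter.exists_infiniteIdeles_eq_of_congruence`: ANY
continuous character `Φ : (K ⊗ ℝ)ˣ → ℂˣ` (no unitarity) killing the infinite parts of the global units
`u ≡ 1 mod 𝔞` is the infinite component of a Hecke character.  Construction (Tate, Cassels–Fröhlich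
VII §4): on the open subgroup `W = (K ⊗ ℝ)ˣ · (W_𝔞 ∩ 𝕌_K)` of `𝕀_K` the character `φ = Φ ∘ (·)_∞` kills
`W ∩ Kˣ = {u ∈ 𝓞_Kˣ : u ≡ 1 mod 𝔞}`, hence extends to a character of `𝕀_K` trivial on `Kˣ` because `ℂˣ`
is divisible (`exists_monoidHom_extension_of_subgroups`, Baer's criterion, sibling `…WeilExtensionAux`);
it is continuous because it agrees with `Φ ∘ (·)_∞` on the neighbourhood `W` of `1`.  (The tree's
`HeckeCharacterArchTypeProofs` proves the unitary case with values in `S¹`; this file is independent of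
it.)
-/

set_option linter.dupNamespace false -- project-wide option (lakefile weak.linter.dupNamespace); `Summit.Langlands.Langlands` is the mandated namespace

noncomputable section

open scoped NumberField
open NumberField IsDedekindDomain NumberField.InfinitePlace NumberField.InfinitePlace.Completion
open Literature.NumberTheory.GaloisRepresentations

namespace Summit.Langlands.Langlands.Theorems.HalfIntegralTwistCM

variable {K : Type} [Field K] [NumberField K]

/-- A principal idele which is a unit idele congruent to `1` at the primes of `𝔞 ≠ 0` is the idele of
a global unit `u` with `u - 1 ∈ 𝔞`. (Same computation as the tree's
`exists_units_sub_one_mem_of_principalIdele`; restated here to stay independent of that module.)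
[folklore] -/
theorem exists_units_map_eq_and_sub_one_mem {𝔞 : Ideal (𝓞 K)} (h𝔞 : 𝔞 ≠ ⊥) {k : Kˣ}
    (hU : principalIdele K k ∈ unitIdeles K)
    (hcong : ∀ v : HeightOneSpectrum (𝓞 K), modulusExp 𝔞 v ≠ 0 →
      Valued.v (((principalIdele K k : ideleGroup K) : AdeleRing (𝓞 K) K).2 v - 1) ≤
        WithZero.exp (-(modulusExp 𝔞 v : ℤ))) :
    ∃ u : (𝓞 K)ˣ, (u : 𝓞 K) - 1 ∈ 𝔞 ∧ Units.map (algebraMap (𝓞 K) K : 𝓞 K →* K) u = k := by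
  obtain ⟨u, hu⟩ := exists_units_eq_of_mem_unitIdeles hU
  refine ⟨u, mem_of_forall_mem_pow_modulusExp h𝔞 fun v hv => ?_, Units.ext hu⟩
  have h := hcong v hv
  rw [principalIdele_snd, ← map_one (algebraMap K (v.adicCompletion K)), ← map_sub,
    valued_algebraMap_adicCompletion, ← hu, ← map_one (algebraMap (𝓞 K) K), ← map_sub,
    HeightOneSpectrum.valuation_of_algebraMap] at h
  exact (HeightOneSpectrum.intValuation_le_pow_iff_mem v _ _).mp h

/-- **Weil's extension lemma for quasi-characters (Weil 1956 §1; Tate, Cassels–Fröhlich VII §4.1).**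
Let `Φ : (K ⊗ ℝ)ˣ → ℂˣ` be a continuous character and `𝔞 ≠ 0` an ideal of `𝓞 K` such that
`Φ((u)_∞) = 1` for every global unit `u ≡ 1 mod 𝔞`.  Then there is a Hecke character `ψ` of `K` with
infinite component `Φ`: `ψ((x, 1)) = Φ(x)` for all `x ∈ (K ⊗ ℝ)ˣ`.  No unitarity is needed: the target
`ℂˣ` is divisible, so the character `Φ ∘ (·)_∞` of the open subgroup `(K ⊗ ℝ)ˣ · (W_𝔞 ∩ 𝕌_K)`, which
kills its principal elements, extends to `𝕀_K/Kˣ` (`exists_monoidHom_extension_of_subgroups`), and the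
extension is continuous because it agrees with `Φ ∘ (·)_∞` near `1`. [cite: Weil1956, §1] -/
theorem HeckeCharacter.exists_infiniteIdeles_eq_of_congruence (Φ : (InfiniteAdeleRing K)ˣ →ₜ* ℂˣ)
    {𝔞 : Ideal (𝓞 K)} (h𝔞 : 𝔞 ≠ ⊥)
    (hker : ∀ u : (𝓞 K)ˣ, (u : 𝓞 K) - 1 ∈ 𝔞 →
      Φ (globalToInfiniteUnits K (Units.map (algebraMap (𝓞 K) K : 𝓞 K →* K) u)) = 1) :
    ∃ ψ : HeckeCharacter K, ∀ x : (InfiniteAdeleRing K)ˣ, ψ (infiniteIdeles K x) = Φ x := by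
  classical
  -- the subgroup `W = (W_𝔞 ∩ 𝕌_K) · (K ⊗ ℝ)ˣ` and the character `φ = Φ ∘ (·)_∞` on it
  set W : Subgroup (ideleGroup K) :=
    (congruenceIdeles 𝔞 ⊓ unitIdeles K) ⊔ (infiniteIdeles K).range with hWdef
  have hWmem : ∀ x ∈ W, x ∈ unitIdeles K ∧ ∀ v : HeightOneSpectrum (𝓞 K), modulusExp 𝔞 v ≠ 0 →
      Valued.v ((x : AdeleRing (𝓞 K) K).2 v - 1) ≤ WithZero.exp (-(modulusExp 𝔞 v : ℤ)) := by
    intro x hx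
    obtain ⟨y, ⟨hyc, hyu⟩, z, ⟨s, rfl⟩, rfl⟩ := Subgroup.mem_sup.mp hx
    have hsu : infiniteIdeles K s ∈ unitIdeles K := fun v => by
      rw [infiniteIdeles_snd]; exact map_one _
    refine ⟨(unitIdeles K).mul_mem hyu hsu, fun v hv => ?_⟩
    rw [ideleGroup_val_snd_mul, infiniteIdeles_snd, mul_one]
    exact hyc.1 v hv
  have hWnhds : (W : Set (ideleGroup K)) ∈ nhds (1 : ideleGroup K) := by
    refine Filter.mem_of_superset (Filter.inter_mem (congruenceIdeles_mem_nhds_one h𝔞)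
      ((isOpen_unitIdeles K).mem_nhds (unitIdeles K).one_mem)) fun x hx => ?_
    exact Subgroup.mem_sup_left ⟨hx.1, hx.2⟩
  let φ : W →* ℂˣ := (Φ.toMonoidHom.comp (HeckeCharacter.infPart K)).comp W.subtype
  have hφ : ∀ w : W, (w : ideleGroup K) ∈ principalIdeles K → φ w = 1 := by
    rintro ⟨x, hx⟩ ⟨k, hk⟩
    obtain ⟨hxu, hxc⟩ := hWmem x hx
    have hk' : principalIdele K k = x := hk
    rw [← hk'] at hxu hxc
    obtain ⟨u, hu, huk⟩ := exists_units_map_eq_and_sub_one_mem h𝔞 hxu hxc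
    change Φ (HeckeCharacter.infPart K x) = 1
    rw [← hk', HeckeCharacter.infPart_principalIdele, ← huk, hker u hu]
  -- extend to a character of `𝕀_K / Kˣ` with values in `ℂˣ`
  obtain ⟨ψ₀, hψ₀P, hψ₀W⟩ := exists_monoidHom_extension_of_subgroups (principalIdeles K) W φ hφ
  have hψ₀W' : ∀ x ∈ W, ψ₀ x = Φ (HeckeCharacter.infPart K x) := fun x hx => by
    rw [show x = ((⟨x, hx⟩ : W) : ideleGroup K) from rfl, hψ₀W]
    rfl
  -- continuity: `ψ₀ = Φ ∘ (·)_∞` near `1`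
  have hcont : Continuous ψ₀ := by
    refine continuous_of_continuousAt_one ψ₀ ?_
    have hc : Continuous fun x : ideleGroup K => Φ (HeckeCharacter.infPart K x) :=
      Φ.continuous.comp HeckeCharacter.continuous_infPart
    refine hc.continuousAt.congr ?_
    exact Filter.eventuallyEq_of_mem hWnhds fun x hx => (hψ₀W' x hx).symm
  refine ⟨⟨⟨ψ₀, hcont⟩, fun x hx => hψ₀P x hx⟩, fun x => ?_⟩
  change ψ₀ (infiniteIdeles K x) = Φ x
  rw [hψ₀W' _ (Subgroup.mem_sup_right ⟨x, rfl⟩), HeckeCharacter.infPart_infiniteIdeles]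

/-- **Stub S2 (`stub_weilExtension`) of line `two-primary-chevalley-core` for crux `HalfIntegralTwistCM`:
Weil's extension theorem in congruence form.**  For a number field `K`, integers `m_w`, reals `t_w`
(`w ∣ ∞`) and a rational modulus `a > 0`: if `∏_w (ι_w u/|ι_w u|)^{m_w} |ι_w u|^{i t_w} = 1` for every
global unit `u ≡ 1 (mod a)`, then some Hecke character `ψ` of `K` has unitary archimedean type `(m, t)`,
`ψ((x, 1)) = ∏_w (ι_w x_w/|ι_w x_w|)^{m_w} |ι_w x_w|^{i t_w}`: package the product as a continuous
character `Φ` of `(K ⊗ ℝ)ˣ` (each factor `archUnitaryValue (m w) (t w) ∘ ι_w` is multiplicative and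
continuous on `ℂˣ`) and apply `HeckeCharacter.exists_infiniteIdeles_eq_of_congruence` with `𝔞 = (a)`.
[cite: Weil1956, §1] [cite: Patrikis2019, Lemma 2.1.1] -/
theorem stub_weilExtension (K : Type) [Field K] [NumberField K]
    (m : InfinitePlace K → ℤ) (t : InfinitePlace K → ℝ) (a : ℕ) (ha : 0 < a)
    (h : ∀ u : (𝓞 K)ˣ, (a : 𝓞 K) ∣ (u : 𝓞 K) - 1 →
      ∏ w : InfinitePlace K, archUnitaryValue (m w) (t w) (w.embedding ((u : 𝓞 K) : K)) = 1) :
    ∃ ψ : HeckeCharacter K, ψ.HasUnitaryArchType m t := by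
  classical
  -- the archimedean character `Φ(x) = ∏_w archUnitaryValue (m w) (t w) (ι_w x_w)` of `(K ⊗ ℝ)ˣ`
  have h0 : ∀ (x : (InfiniteAdeleRing K)ˣ) (w : InfinitePlace K),
      extensionEmbedding w ((x : InfiniteAdeleRing K) w) ≠ 0 :=
    fun x w => InfiniteIdele.extensionEmbedding_apply_ne_zero x w
  let f : (InfiniteAdeleRing K)ˣ →* ℂ :=
    { toFun := fun x => ∏ w : InfinitePlace K,
        archUnitaryValue (m w) (t w) (extensionEmbedding w ((x : InfiniteAdeleRing K) w))
      map_one' := by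
        refine Finset.prod_eq_one fun w _ => ?_
        have e : ((1 : (InfiniteAdeleRing K)ˣ) : InfiniteAdeleRing K) w = 1 := rfl
        rw [e, map_one]
        simp [archUnitaryValue]
      map_mul' := fun x y => by
        rw [← Finset.prod_mul_distrib]
        refine Finset.prod_congr rfl fun w _ => ?_
        have e : ((x * y : (InfiniteAdeleRing K)ˣ) : InfiniteAdeleRing K) w =
            (x : InfiniteAdeleRing K) w * (y : InfiniteAdeleRing K) w := rfl
        rw [e, map_mul, archUnitaryValue_mul'] }
  have hfx : ∀ x, f x = ∏ w : InfinitePlace K,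
      archUnitaryValue (m w) (t w) (extensionEmbedding w ((x : InfiniteAdeleRing K) w)) := fun x => rfl
  have hf : ∀ x, f x ≠ 0 := fun x => by
    rw [hfx]
    exact Finset.prod_ne_zero_iff.mpr fun w _ => norm_ne_zero_iff.mp
      (by rw [norm_archUnitaryValue (h0 x w)]; exact one_ne_zero)
  have hfc : Continuous f := by
    change Continuous fun x : (InfiniteAdeleRing K)ˣ => ∏ w : InfinitePlace K,
      archUnitaryValue (m w) (t w) (extensionEmbedding w ((x : InfiniteAdeleRing K) w))
    refine continuous_finsetProd _ fun w _ => ?_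
    have hc : Continuous fun x : (InfiniteAdeleRing K)ˣ =>
        extensionEmbedding w ((x : InfiniteAdeleRing K) w) :=
      (isometry_extensionEmbedding w).continuous.comp ((continuous_apply w).comp Units.continuous_val)
    refine continuous_iff_continuousAt.mpr fun x => ?_
    exact (continuousAt_archUnitaryValue (m w) (t w) (h0 x w)).comp
      (f := fun x : (InfiniteAdeleRing K)ˣ => extensionEmbedding w ((x : InfiniteAdeleRing K) w))
      hc.continuousAt
  let Φ₀ : (InfiniteAdeleRing K)ˣ →* ℂˣ := f.toHomUnits
  have hΦ₀ : ∀ x, (Φ₀ x : ℂ) = f x := fun x => rfl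
  have hcont : Continuous Φ₀ := by
    refine Units.continuous_iff.mpr ⟨hfc, ?_⟩
    have e : (fun x : (InfiniteAdeleRing K)ˣ => ((Φ₀ x)⁻¹ : ℂˣ).val) = fun x => (f x)⁻¹ := by
      funext x; rw [Units.val_inv_eq_inv_val]; rfl
    rw [e]
    exact hfc.inv₀ hf
  let Φ : (InfiniteAdeleRing K)ˣ →ₜ* ℂˣ := ⟨Φ₀, hcont⟩
  have hΦ : ∀ x, (Φ x : ℂ) = f x := fun x => rfl
  -- the congruence hypothesis, read on `Φ`
  have ha0 : (a : 𝓞 K) ≠ 0 := Nat.cast_ne_zero.mpr ha.ne'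
  have h𝔞 : Ideal.span {(a : 𝓞 K)} ≠ ⊥ := by
    rw [Ne, Ideal.span_singleton_eq_bot]
    exact ha0
  have hkerΦ : ∀ u : (𝓞 K)ˣ, (u : 𝓞 K) - 1 ∈ Ideal.span {(a : 𝓞 K)} →
      Φ (globalToInfiniteUnits K (Units.map (algebraMap (𝓞 K) K : 𝓞 K →* K) u)) = 1 := by
    intro u hu
    apply Units.ext
    rw [hΦ, Units.val_one, hfx, ← h u (Ideal.mem_span_singleton.mp hu)]
    refine Finset.prod_congr rfl fun w _ => ?_
    have e : extensionEmbedding w ((globalToInfiniteUnits K (Units.map (algebraMap (𝓞 K) K : 𝓞 K →* K) u) :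
        InfiniteAdeleRing K) w) = w.embedding (((u : 𝓞 K) : K)) := by
      rw [val_globalToInfiniteUnits, InfiniteAdeleRing.algebraMap_apply]
      exact extensionEmbedding_coe w (WithAbs.toAbs w.1 ((u : 𝓞 K) : K))
    rw [e]
  obtain ⟨ψ, hψ⟩ := HeckeCharacter.exists_infiniteIdeles_eq_of_congruence Φ h𝔞 hkerΦ
  exact ⟨ψ, fun x => by rw [hψ x, hΦ x, hfx]⟩

end Summit.Langlands.Langlands.Theorems.HalfIntegralTwistCM

end
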